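import Summits.BirchSwinnertonDyer.BirchSwinnertonDyer.Theorems.ByReductionTypeAtTwoNoFiniteSubmoduleRankZero
import Summits.BirchSwinnertonDyer.BirchSwinnertonDyer.Theorems.ByReductionTypeAtTwoTowerDoorsMuFree
import Summits.BirchSwinnertonDyer.BirchSwinnertonDyer.Theorems.ByReductionTypeAtTwoTowerLayerRank
import Summits.BirchSwinnertonDyer.BirchSwinnertonDyer.Theorems.ByReductionTypeAtTwoEulerCharAtTwoAll
import HarnessLib

/-!
# Route `ByReductionTypeAtTwo` (K4), TOWER road — the `λ`-road TOWER doors at analytic rank `0` WITHOUT `h414`: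
# on {`GoodOrd W 2`, `Irr W 2`, `r_an = 0`} the binder `h414` (Greenberg Prop. 4.14@2) is a consequence of `hGZK`

Cell `bsd-2adic`, seat `bsd-2adic-tower-1` (GEN 26), `--supports stmt-BirchSwinnertonDyer-19271` (helper). THEOREMS ONLY
(no definition, no named fact, no `sorry`); closes nothing by itself; no door re-keyed (D-0152); BSD is not proved by any of this.

The `λ`-road TOWER doors (`KatoHalfPinch.…_of_towerGap_of_towerRank` / `…_of_layerSelmer`, `TowerClass.…_of_irr`) take the
algebraic lower bound `n ≤ λ(X)` from a finite-layer RANK certificate (`2^n ≤ #X/(2,T^j)X`, or `2^n ≤ #Sel_{2^∞}(E/ℚ_j)[2]`)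
through «`X(E/ℚ_∞)` has no nonzero finite `Λ`-submodule», displayed as the PRINT binder
`h414 : Greenberg1999.prop414_noFiniteSubmodule_of_not_dvd_torsionOrder`. The companion file
`…NoFiniteSubmoduleRankZero` proves that input in the kernel on {`GoodOrd W p`, `Sel_{p^∞}(E/ℚ)` finite, `E(ℚ)[p] = 0`}
(`(Sel_∞)_γ = 0` ⇒ `X[T] = 0` ⇒ Nakayama; Greenberg LNM 1716 p. 104). This file re-derives the doors accordingly:

* §1 `le_lambda_of_towerGap_of_towerRank_of_finiteSelmer` / `…_of_irr_rankZero` / `le_lambda_of_towerGap_of_layerSelmer_of_irr_rankZero`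
  — `n ≤ λ(X)` from the gap + rank certificates WITHOUT `h414`: `Sel_{2^∞}(E/ℚ)` finite + `E(ℚ)[2] = 0`, resp. `Irr W 2` +
  `r_an = 0` + `hGZK` (Gross–Zagier–Kolyvagin, already a K4 published input).
* §2 the doors AT `W` on {`GoodOrd W 2`, `Irr W 2`, `W.analyticRank = 0`}, tower-rank and layer forms:
  `katoHalfAt_two_…_of_irr_rankZero` (the item `OrdKatoHalfAtTwo` AT `W` — its own signature carries `r_an = 0`) and
  `mazurMainConjecture_two_…` / `eisensteinAt_two_…` from PRINT {`hGZK`, `h17` Kato 17.4 (1)(2)@2, `hAU` Abbes–Ullmo} + CERT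
  {`TowerGapAtTwo W`, rank certificate, `λ_an = n`}; `bsdp_two_…_of_irr_rankZero` from PRINT {`hmod`, `hGZK`, `h17`, `hAU`} + the
  same certificates — `hEC` (GEN 25 `GreenbergEulerChar.twoAdicEulerCharRankZero_of_irr`), `h414` (this GEN), `hμan` (GEN 24
  `AnalyticMuTwo.analyticMuLE_two_zero_of_goodOrd_of_irr_of_abbesUllmo`), `hper₀` and `htors` (`TowerClass.…_of_irr`) all DERIVED.

LEDGER READING after this file (instrument, D-0152): on the 440 `E[2]`-irreducible good-ordinary X5@2 rows the TOWER `BSD₂` door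
is PRINT {modularity, GZK, Kato 17.4 (1)(2)@2, Abbes–Ullmo Thm. A} + CERT {tower gap, layer rank, `λ_an`}; Greenberg's Thm. 4.1@2,
Prop. 4.14@2 and `μ_an = 0` are kernel theorems there. Nothing is re-keyed here.

References: [GreenbergLNM1716] §4 p. 104, Thm. 4.1, Prop. 4.14; [Kato2004Asterisque] Thm. 17.4 (1)(2) (p. 273);
[AbbesUllmo1996] Thm. A; [Darmon2004] Thm. 3.22; [Miller2011LMS] Def. 1.1; [Washington1997] §13.2.
-/

set_option autoImplicit false
-- justification: the mandated namespace `Summit.BirchSwinnertonDyer.BirchSwinnertonDyer.Theorems`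
-- (single-conjunct summit, Sub = Summit) repeats a segment by design (D-0017).
set_option linter.dupNamespace false

noncomputable section

open scoped Classical MatrixGroups ModularForm

open NumberField IsDedekindDomain CongruenceSubgroup WeierstrassCurve Literature.NumberTheory.EllipticCurves
  Literature.NumberTheory.EllipticCurves.ModularForms Literature.NumberTheory.EllipticCurves.Rank1Residual
  Literature.NumberTheory.EllipticCurves.Rank1Residual.Typed
  Literature.NumberTheory.EllipticCurves.Greenberg1999
  Literature.NumberTheory.EllipticCurves.SkinnerUrban2014
  Summit.BirchSwinnertonDyer.Rank1Residual.X1.MuLambda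
  Summit.BirchSwinnertonDyer.Rank1Residual.X1.MuPart
  Summit.BirchSwinnertonDyer.Rank1Residual.X1.ParitySqueeze
  Summit.BirchSwinnertonDyer.BirchSwinnertonDyer.Theorems.Rank1ResidualX1Defs
  Summit.BirchSwinnertonDyer.Rank1Residual.X5 Summit.BirchSwinnertonDyer.Rank1Residual.X5.O1
  Summit.BirchSwinnertonDyer.Rank1Residual.X5.TowerGap
  Summit.BirchSwinnertonDyer.BirchSwinnertonDyer.Theorems.GreenbergFiniteSub

/-! ## §1 `n ≤ λ(X(E/ℚ_∞))` from the gap + rank certificates, WITHOUT `h414` -/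

namespace Summit.BirchSwinnertonDyer.BirchSwinnertonDyer.Theorems.KatoHalfPinch

section Curve

variable (W : WeierstrassCurve ℚ) [W.IsElliptic] [W.IsGloballyMinimal]

/-- **`n ≤ λ(X)` without `h414`, Selmer-finite form.** `W/ℚ` globally minimal and elliptic with `GoodOrd W 2`,
`Sel_{2^∞}(E/ℚ)` finite and `E(ℚ)[2] = 0`; certificates `TowerGapAtTwo W` (`X` torsion, `μ = 0`) and the RANK certificate
`∃ j, 2^n ≤ #X/(2,T^j)X` for every cyclotomic datum. Then `n ≤ λ(X)` for every cyclotomic datum — the no-finite-submodule input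
is `GreenbergFiniteSub.forall_finite_eq_bot_of_goodOrd_of_noPTorsion` (kernel) instead of Greenberg Prop. 4.14@2 (print).
[cite: GreenbergLNM1716, §4 p. 104, Prop. 4.14] [cite: Washington1997, §13.2] -/
theorem le_lambda_of_towerGap_of_towerRank_of_finiteSelmer (hgo : GoodOrd W 2) [Finite (W.selmerGroupPInfty 2)]
    (hK : ∀ P : W.toAffine.Point, 2 • P = 0 → P = 0) (hgap : TowerGapAtTwo W) {n : ℕ}
    (hrank : ∀ (κ : ZpExtension ℚ 2) (γ : Field.absoluteGaloisGroup ℚ), κ.IsCyclotomic →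
      κ.IsTopGenerator γ → IsCyclotomicVariable 2 γ → ∀ D : W.SelmerDualData κ γ,
      ∃ j : ℕ, 2 ^ n ≤ Nat.card (D.X ⧸ (towerIdeal 2 j • ⊤ : Submodule (IwasawaAlgebra 2) D.X)))
    (κ : ZpExtension ℚ 2) (γ : Field.absoluteGaloisGroup ℚ) (hκ : κ.IsCyclotomic)
    (hγ : κ.IsTopGenerator γ) (hγ' : IsCyclotomicVariable 2 γ) (D : W.SelmerDualData κ γ) :
    n ≤ D.lambda := by
  haveI : Fact (Nat.Prime 2) := ⟨Nat.prime_two⟩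
  haveI : Module.Finite (IwasawaAlgebra 2) D.X := D.module_finite_holds hγ
  obtain ⟨hX, hμ⟩ := isTorsion_and_mu_eq_zero_of_towerGapAtTwo W hgap hκ hγ hγ' D
  obtain ⟨j, hj⟩ := hrank κ γ hκ hγ hγ' D
  exact le_lambdaInvariant_of_pow_le_natCard_quotient_towerIdeal 2 hX hμ
    (forall_finite_eq_bot_of_goodOrd_of_noPTorsion W hgo κ hκ hγ hK D) hj

/-- **`n ≤ λ(X)` without `h414` on the `E[2]`-irreducible rank-`0` rows**: `GoodOrd W 2`, `Irr W 2`, `W.analyticRank = 0`,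
PRINT `hGZK` (so `Sel_{2^∞}(E/ℚ)` is finite and `E(ℚ)[2] = 0`), + the two certificates.
[cite: GreenbergLNM1716, §4 p. 104, Prop. 4.14] [cite: Darmon2004, Thm. 3.22] -/
theorem le_lambda_of_towerGap_of_towerRank_of_irr_rankZero (hGZK : rank_eq_analyticRank_of_analyticRank_le_one)
    (hgo : GoodOrd W 2) (hirr : Irr W 2) (hr : W.analyticRank = 0) (hgap : TowerGapAtTwo W) {n : ℕ}
    (hrank : ∀ (κ : ZpExtension ℚ 2) (γ : Field.absoluteGaloisGroup ℚ), κ.IsCyclotomic →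
      κ.IsTopGenerator γ → IsCyclotomicVariable 2 γ → ∀ D : W.SelmerDualData κ γ,
      ∃ j : ℕ, 2 ^ n ≤ Nat.card (D.X ⧸ (towerIdeal 2 j • ⊤ : Submodule (IwasawaAlgebra 2) D.X)))
    (κ : ZpExtension ℚ 2) (γ : Field.absoluteGaloisGroup ℚ) (hκ : κ.IsCyclotomic)
    (hγ : κ.IsTopGenerator γ) (hγ' : IsCyclotomicVariable 2 γ) (D : W.SelmerDualData κ γ) :
    n ≤ D.lambda := by
  haveI : Fact (Nat.Prime 2) := ⟨Nat.prime_two⟩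
  haveI : Module.Finite (IwasawaAlgebra 2) D.X := D.module_finite_holds hγ
  obtain ⟨hX, hμ⟩ := isTorsion_and_mu_eq_zero_of_towerGapAtTwo W hgap hκ hγ hγ' D
  obtain ⟨j, hj⟩ := hrank κ γ hκ hγ hγ' D
  exact le_lambdaInvariant_of_pow_le_natCard_quotient_towerIdeal 2 hX hμ
    (forall_finite_eq_bot_two_of_irr W hGZK hgo hirr hr κ γ hκ hγ D) hj

/-- **`n ≤ λ(X)` without `h414`, LAYER form**: the rank certificate read off a finite layer, `2^n ≤ #Sel_{2^∞}(E/ℚ_j)[2]`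
for every cyclotomic `κ` (`towerRank_of_layerSelmerTwoTorsion`), on {`GoodOrd W 2`, `Irr W 2`, `r_an = 0`} with `hGZK`.
[cite: GreenbergLNM1716, §1 p. 60, §3 pp. 85–86, §4 p. 104] [cite: Darmon2004, Thm. 3.22] -/
theorem le_lambda_of_towerGap_of_layerSelmer_of_irr_rankZero (hGZK : rank_eq_analyticRank_of_analyticRank_le_one)
    (hgo : GoodOrd W 2) (hirr : Irr W 2) (hr : W.analyticRank = 0) (hgap : TowerGapAtTwo W) {j n : ℕ}
    (hsel : ∀ κ : ZpExtension ℚ 2, κ.IsCyclotomic →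
      2 ^ n ≤ Nat.card {z : W.selmerLayer κ j // 2 • z = 0})
    (κ : ZpExtension ℚ 2) (γ : Field.absoluteGaloisGroup ℚ) (hκ : κ.IsCyclotomic)
    (hγ : κ.IsTopGenerator γ) (hγ' : IsCyclotomicVariable 2 γ) (D : W.SelmerDualData κ γ) :
    n ≤ D.lambda :=
  le_lambda_of_towerGap_of_towerRank_of_irr_rankZero W hGZK hgo hirr hr hgap
    (towerRank_of_layerSelmerTwoTorsion W (TowerClass.not_two_dvd_torsionOrder_of_irr W hirr) hsel) κ γ hκ hγ hγ' D

end Curve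

end Summit.BirchSwinnertonDyer.BirchSwinnertonDyer.Theorems.KatoHalfPinch

/-! ## §2 The doors AT `W` on {`GoodOrd W 2`, `Irr W 2`, `W.analyticRank = 0`} — `h414`, `hEC`, `hμan`, `hper₀`, `htors` derived -/

namespace Summit.BirchSwinnertonDyer.BirchSwinnertonDyer.Theorems.TowerClass

open Summit.BirchSwinnertonDyer.BirchSwinnertonDyer.Theorems.KatoHalfPinch
  Summit.BirchSwinnertonDyer.BirchSwinnertonDyer.Theorems.AnalyticMuTwo

section TowerRank

variable (W : WeierstrassCurve ℚ) [W.IsElliptic] [W.IsGloballyMinimal]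

/-- **The Kato–Néron half — the item `OrdKatoHalfAtTwo` AT `W` — tower-rank form, rank `0`, WITHOUT `h414`**: PRINT
{`hGZK`, `h17` Kato 17.4 (1)(2)@2, `hAU` Abbes–Ullmo} + kernel {`GoodOrd W 2`, `Irr W 2`, `W.analyticRank = 0`} + CERT
{`TowerGapAtTwo W`, `∃ j, 2^n ≤ #X/(2,T^j)X`, `λ_an = n`}. (`hper₀`, `hμan` from `hAU` + `Irr`; `n ≤ λ(X)` by §1.)
[cite: Kato2004Asterisque, Thm. 17.4 (1)(2) (p. 273)] [cite: AbbesUllmo1996, Thm. A] [cite: GreenbergLNM1716, §4 p. 104]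
[cite: Darmon2004, Thm. 3.22] -/
theorem katoHalfAt_two_of_towerGap_of_towerRank_of_irr_rankZero (hGZK : rank_eq_analyticRank_of_analyticRank_le_one)
    (h17 : ∀ [NeZero (W.conductorNorm ℤ)] (f : CuspForm (Gamma0 (W.conductorNorm ℤ)) 2),
      kato_divisibility_allPrimes W 2 (f := f))
    (hAU : abbesUllmo_not_dvd_maninConstant_of_not_dvd_level) (hgo : GoodOrd W 2) (hirr : Irr W 2)
    (hr : W.analyticRank = 0) (hgap : TowerGapAtTwo W) {n : ℕ}
    (hrank : ∀ (κ : ZpExtension ℚ 2) (γ : Field.absoluteGaloisGroup ℚ), κ.IsCyclotomic →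
      κ.IsTopGenerator γ → IsCyclotomicVariable 2 γ → ∀ D : W.SelmerDualData κ γ,
      ∃ j : ℕ, 2 ^ n ≤ Nat.card (D.X ⧸ (towerIdeal 2 j • ⊤ : Submodule (IwasawaAlgebra 2) D.X)))
    (hlan : AnalyticLambdaEq W 2 n) : MainConjectureLowerDivisibilityAtTwoOrd W :=
  katoHalfAt_two_of_towerGap_of_lambda_le W h17 (periodRatio_nonneg_of_irr_two_of_abbesUllmo W hAU hgo hirr) hgo hgap hlan
    (analyticMuLE_two_zero_of_goodOrd_of_irr_of_abbesUllmo W hAU hgo hirr)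
    (le_lambda_of_towerGap_of_towerRank_of_irr_rankZero W hGZK hgo hirr hr hgap hrank)

/-- **The `2`-adic IMC AT `W`, tower-rank form, rank `0`, WITHOUT `h414`**: PRINT {`hGZK`, `h17`, `hAU`} + kernel {`GoodOrd W 2`,
`Irr W 2`, `r_an = 0`} + CERT {gap, rank, `λ_an = n`}. [cite: Kato2004Asterisque, Thm. 17.4 (1)(2) (p. 273)]
[cite: AbbesUllmo1996, Thm. A] [cite: GreenbergLNM1716, §4 p. 104] [cite: Darmon2004, Thm. 3.22] -/
theorem mazurMainConjecture_two_of_towerGap_of_towerRank_of_irr_rankZero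
    (hGZK : rank_eq_analyticRank_of_analyticRank_le_one)
    (h17 : ∀ [NeZero (W.conductorNorm ℤ)] (f : CuspForm (Gamma0 (W.conductorNorm ℤ)) 2),
      kato_divisibility_allPrimes W 2 (f := f))
    (hAU : abbesUllmo_not_dvd_maninConstant_of_not_dvd_level) (hgo : GoodOrd W 2) (hirr : Irr W 2)
    (hr : W.analyticRank = 0) (hgap : TowerGapAtTwo W) {n : ℕ}
    (hrank : ∀ (κ : ZpExtension ℚ 2) (γ : Field.absoluteGaloisGroup ℚ), κ.IsCyclotomic →
      κ.IsTopGenerator γ → IsCyclotomicVariable 2 γ → ∀ D : W.SelmerDualData κ γ,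
      ∃ j : ℕ, 2 ^ n ≤ Nat.card (D.X ⧸ (towerIdeal 2 j • ⊤ : Submodule (IwasawaAlgebra 2) D.X)))
    (hlan : AnalyticLambdaEq W 2 n) : MazurMainConjecture W 2 :=
  mazurMainConjecture_two_of_towerGap_of_lambda_le W h17 (periodRatio_nonneg_of_irr_two_of_abbesUllmo W hAU hgo hirr) hgo
    hgap hlan (analyticMuLE_two_zero_of_goodOrd_of_irr_of_abbesUllmo W hAU hgo hirr)
    (le_lambda_of_towerGap_of_towerRank_of_irr_rankZero W hGZK hgo hirr hr hgap hrank)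

/-- **The Eisenstein half AT `W`, tower-rank form, rank `0`, WITHOUT `h414`** (from the IMC). [cite: Kato2004Asterisque, Thm. 17.4 (1)(2) (p. 273)]
[cite: AbbesUllmo1996, Thm. A] [cite: GreenbergLNM1716, §4 p. 104] [cite: Darmon2004, Thm. 3.22] -/
theorem eisensteinAt_two_of_towerGap_of_towerRank_of_irr_rankZero (hGZK : rank_eq_analyticRank_of_analyticRank_le_one)
    (h17 : ∀ [NeZero (W.conductorNorm ℤ)] (f : CuspForm (Gamma0 (W.conductorNorm ℤ)) 2),
      kato_divisibility_allPrimes W 2 (f := f))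
    (hAU : abbesUllmo_not_dvd_maninConstant_of_not_dvd_level) (hgo : GoodOrd W 2) (hirr : Irr W 2)
    (hr : W.analyticRank = 0) (hgap : TowerGapAtTwo W) {n : ℕ}
    (hrank : ∀ (κ : ZpExtension ℚ 2) (γ : Field.absoluteGaloisGroup ℚ), κ.IsCyclotomic →
      κ.IsTopGenerator γ → IsCyclotomicVariable 2 γ → ∀ D : W.SelmerDualData κ γ,
      ∃ j : ℕ, 2 ^ n ≤ Nat.card (D.X ⧸ (towerIdeal 2 j • ⊤ : Submodule (IwasawaAlgebra 2) D.X)))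
    (hlan : AnalyticLambdaEq W 2 n) : MainConjectureEisensteinDivisibilityAtTwo W :=
  eisensteinAt_two_of_towerGap_of_lambda_le W h17 (periodRatio_nonneg_of_irr_two_of_abbesUllmo W hAU hgo hirr) hgo hgap
    hlan (analyticMuLE_two_zero_of_goodOrd_of_irr_of_abbesUllmo W hAU hgo hirr)
    (le_lambda_of_towerGap_of_towerRank_of_irr_rankZero W hGZK hgo hirr hr hgap hrank)

/-- **`BSDp W 2` at analytic rank `0`, tower-rank form, WITHOUT `hEC`, `h414`, `hμan`, `hper₀`, `htors`**: PRINT {`hmod`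
modularity, `hGZK` Gross–Zagier–Kolyvagin, `h17` Kato 17.4 (1)(2)@2, `hAU` Abbes–Ullmo} + kernel {`GoodOrd W 2`, `Irr W 2`,
`W.analyticRank = 0`} + CERT {`TowerGapAtTwo W`, `∃ j, 2^n ≤ #X/(2,T^j)X`, `λ_an = n`} ⇒ `BSDp W 2`. `hEC` = GEN 25
`GreenbergEulerChar.twoAdicEulerCharRankZero_of_irr`; `h414` = this GEN; `hμan`, `hper₀`, `htors` = GEN 24 / `TowerClass`.
[cite: GreenbergLNM1716, Thm. 4.1, §4 p. 104, Prop. 4.14] [cite: Kato2004Asterisque, Thm. 17.4 (1)(2) (p. 273)]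
[cite: AbbesUllmo1996, Thm. A] [cite: Darmon2004, Thm. 3.22] [cite: Miller2011LMS, Def. 1.1] -/
theorem bsdp_two_of_towerGap_of_towerRank_of_irr_rankZero (hmod : nonempty_modularParametrizationData)
    (hGZK : rank_eq_analyticRank_of_analyticRank_le_one)
    (h17 : ∀ [NeZero (W.conductorNorm ℤ)] (f : CuspForm (Gamma0 (W.conductorNorm ℤ)) 2),
      kato_divisibility_allPrimes W 2 (f := f))
    (hAU : abbesUllmo_not_dvd_maninConstant_of_not_dvd_level) (hgo : GoodOrd W 2) (hirr : Irr W 2)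
    (hr : W.analyticRank = 0) (hgap : TowerGapAtTwo W) {n : ℕ}
    (hrank : ∀ (κ : ZpExtension ℚ 2) (γ : Field.absoluteGaloisGroup ℚ), κ.IsCyclotomic →
      κ.IsTopGenerator γ → IsCyclotomicVariable 2 γ → ∀ D : W.SelmerDualData κ γ,
      ∃ j : ℕ, 2 ^ n ≤ Nat.card (D.X ⧸ (towerIdeal 2 j • ⊤ : Submodule (IwasawaAlgebra 2) D.X)))
    (hlan : AnalyticLambdaEq W 2 n) : BSDp W 2 :=
  bsdp_two_of_towerGap_of_lambda_le W hmod hGZK h17 (GreenbergEulerChar.twoAdicEulerCharRankZero_of_irr W hirr)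
    (periodRatio_nonneg_of_irr_two_of_abbesUllmo W hAU hgo hirr) hgo hr hgap hlan
    (analyticMuLE_two_zero_of_goodOrd_of_irr_of_abbesUllmo W hAU hgo hirr)
    (le_lambda_of_towerGap_of_towerRank_of_irr_rankZero W hGZK hgo hirr hr hgap hrank)

end TowerRank

section LayerSelmer

variable (W : WeierstrassCurve ℚ) [W.IsElliptic] [W.IsGloballyMinimal]

/-- **The Kato–Néron half (item `OrdKatoHalfAtTwo` AT `W`), LAYER form, rank `0`, WITHOUT `h414`**: PRINT {`hGZK`, `h17`,
`hAU`} + kernel {`GoodOrd W 2`, `Irr W 2`, `r_an = 0`} + CERT {`TowerGapAtTwo W`, `2^n ≤ #Sel_{2^∞}(E/ℚ_j)[2]`, `λ_an = n`}.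
[cite: Kato2004Asterisque, Thm. 17.4 (1)(2) (p. 273)] [cite: AbbesUllmo1996, Thm. A] [cite: GreenbergLNM1716, §3 pp. 85–86, §4 p. 104]
[cite: Darmon2004, Thm. 3.22] -/
theorem katoHalfAt_two_of_towerGap_of_layerSelmer_of_irr_rankZero (hGZK : rank_eq_analyticRank_of_analyticRank_le_one)
    (h17 : ∀ [NeZero (W.conductorNorm ℤ)] (f : CuspForm (Gamma0 (W.conductorNorm ℤ)) 2),
      kato_divisibility_allPrimes W 2 (f := f))
    (hAU : abbesUllmo_not_dvd_maninConstant_of_not_dvd_level) (hgo : GoodOrd W 2) (hirr : Irr W 2)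
    (hr : W.analyticRank = 0) (hgap : TowerGapAtTwo W) {j n : ℕ}
    (hsel : ∀ κ : ZpExtension ℚ 2, κ.IsCyclotomic →
      2 ^ n ≤ Nat.card {z : W.selmerLayer κ j // 2 • z = 0})
    (hlan : AnalyticLambdaEq W 2 n) : MainConjectureLowerDivisibilityAtTwoOrd W :=
  katoHalfAt_two_of_towerGap_of_towerRank_of_irr_rankZero W hGZK h17 hAU hgo hirr hr hgap
    (towerRank_of_layerSelmerTwoTorsion W (not_two_dvd_torsionOrder_of_irr W hirr) hsel) hlan

/-- **The `2`-adic IMC AT `W`, LAYER form, rank `0`, WITHOUT `h414`.** [cite: Kato2004Asterisque, Thm. 17.4 (1)(2) (p. 273)]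
[cite: AbbesUllmo1996, Thm. A] [cite: GreenbergLNM1716, §3 pp. 85–86, §4 p. 104] [cite: Darmon2004, Thm. 3.22] -/
theorem mazurMainConjecture_two_of_towerGap_of_layerSelmer_of_irr_rankZero
    (hGZK : rank_eq_analyticRank_of_analyticRank_le_one)
    (h17 : ∀ [NeZero (W.conductorNorm ℤ)] (f : CuspForm (Gamma0 (W.conductorNorm ℤ)) 2),
      kato_divisibility_allPrimes W 2 (f := f))
    (hAU : abbesUllmo_not_dvd_maninConstant_of_not_dvd_level) (hgo : GoodOrd W 2) (hirr : Irr W 2)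
    (hr : W.analyticRank = 0) (hgap : TowerGapAtTwo W) {j n : ℕ}
    (hsel : ∀ κ : ZpExtension ℚ 2, κ.IsCyclotomic →
      2 ^ n ≤ Nat.card {z : W.selmerLayer κ j // 2 • z = 0})
    (hlan : AnalyticLambdaEq W 2 n) : MazurMainConjecture W 2 :=
  mazurMainConjecture_two_of_towerGap_of_towerRank_of_irr_rankZero W hGZK h17 hAU hgo hirr hr hgap
    (towerRank_of_layerSelmerTwoTorsion W (not_two_dvd_torsionOrder_of_irr W hirr) hsel) hlan

/-- **The Eisenstein half AT `W`, LAYER form, rank `0`, WITHOUT `h414`.** [cite: Kato2004Asterisque, Thm. 17.4 (1)(2) (p. 273)]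
[cite: AbbesUllmo1996, Thm. A] [cite: GreenbergLNM1716, §3 pp. 85–86, §4 p. 104] [cite: Darmon2004, Thm. 3.22] -/
theorem eisensteinAt_two_of_towerGap_of_layerSelmer_of_irr_rankZero
    (hGZK : rank_eq_analyticRank_of_analyticRank_le_one)
    (h17 : ∀ [NeZero (W.conductorNorm ℤ)] (f : CuspForm (Gamma0 (W.conductorNorm ℤ)) 2),
      kato_divisibility_allPrimes W 2 (f := f))
    (hAU : abbesUllmo_not_dvd_maninConstant_of_not_dvd_level) (hgo : GoodOrd W 2) (hirr : Irr W 2)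
    (hr : W.analyticRank = 0) (hgap : TowerGapAtTwo W) {j n : ℕ}
    (hsel : ∀ κ : ZpExtension ℚ 2, κ.IsCyclotomic →
      2 ^ n ≤ Nat.card {z : W.selmerLayer κ j // 2 • z = 0})
    (hlan : AnalyticLambdaEq W 2 n) : MainConjectureEisensteinDivisibilityAtTwo W :=
  eisensteinAt_two_of_towerGap_of_towerRank_of_irr_rankZero W hGZK h17 hAU hgo hirr hr hgap
    (towerRank_of_layerSelmerTwoTorsion W (not_two_dvd_torsionOrder_of_irr W hirr) hsel) hlan

/-- **`BSDp W 2` at analytic rank `0`, LAYER form, WITHOUT `hEC`, `h414`, `hμan`, `hper₀`, `htors`**: PRINT {`hmod`, `hGZK`,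
`h17`, `hAU`} + kernel {`GoodOrd W 2`, `Irr W 2`, `W.analyticRank = 0`} + CERT {`TowerGapAtTwo W`,
`2^n ≤ #Sel_{2^∞}(E/ℚ_j)[2]`, `λ_an = n`} ⇒ `BSDp W 2`. [cite: GreenbergLNM1716, Thm. 4.1, §3 pp. 85–86, §4 p. 104, Prop. 4.14]
[cite: Kato2004Asterisque, Thm. 17.4 (1)(2) (p. 273)] [cite: AbbesUllmo1996, Thm. A] [cite: Darmon2004, Thm. 3.22]
[cite: Miller2011LMS, Def. 1.1] -/
theorem bsdp_two_of_towerGap_of_layerSelmer_of_irr_rankZero (hmod : nonempty_modularParametrizationData)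
    (hGZK : rank_eq_analyticRank_of_analyticRank_le_one)
    (h17 : ∀ [NeZero (W.conductorNorm ℤ)] (f : CuspForm (Gamma0 (W.conductorNorm ℤ)) 2),
      kato_divisibility_allPrimes W 2 (f := f))
    (hAU : abbesUllmo_not_dvd_maninConstant_of_not_dvd_level) (hgo : GoodOrd W 2) (hirr : Irr W 2)
    (hr : W.analyticRank = 0) (hgap : TowerGapAtTwo W) {j n : ℕ}
    (hsel : ∀ κ : ZpExtension ℚ 2, κ.IsCyclotomic →
      2 ^ n ≤ Nat.card {z : W.selmerLayer κ j // 2 • z = 0})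
    (hlan : AnalyticLambdaEq W 2 n) : BSDp W 2 :=
  bsdp_two_of_towerGap_of_towerRank_of_irr_rankZero W hmod hGZK h17 hAU hgo hirr hr hgap
    (towerRank_of_layerSelmerTwoTorsion W (not_two_dvd_torsionOrder_of_irr W hirr) hsel) hlan

end LayerSelmer

end Summit.BirchSwinnertonDyer.BirchSwinnertonDyer.Theorems.TowerClass

end
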